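import Mathlib
import Literature.AlgebraicGeometry.Motives.RigidityIndexEven
import Literature.NumberTheory.LFunctions.WeilConjecturesDeligneKunnethProofs

/-!
# SoloInformedAltObstruction — the linear-algebra heart of G3″ (solo-Langlands-informed, Part II §7.8)

In Part II §7.8 (Lemmas A, B, C) of the solo-informed programme the first-order obstruction to an
IRREDUCIBLE level-one flat pseudodeformation of `𝟙 ⊕ ω` over `X = Spec O_F` (`F` imaginary
quadratic, `p ≥ 5` unramified) is a linear map
`ū : B̄ ⊗ C̄ → B̄^∨`, `B̄ = H¹_fl(X, μ_p)` (dimension `r = rk_p Cl_F`), `C̄ = Ext¹_𝒞(ω, 𝟙)`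
(dimension `s = rk_p K_2(O_F)`), whose slices `b ⊗ c ↦ τ(b, c, ·)` are ALTERNATING in the two
`B̄`-variables (Lemma A: `τ(b, c, b″) = ∫_X b ∪ c_c ∪ b″` is skew in `(b, b″)`; Lemma C: the obstruction
group is `H²_fl(X, ℤ/p) ≅ B̄^∨`).  An unobstructed non-zero first-order class exists — equivalently the
reducibility ideal satisfies `J ⊄ 𝔪_R² + (p)`, in particular `J ≠ 0` (consequence G3″) — as soon as
`ker ū ≠ 0`.  This file is the kernel-checked linear algebra behind G3″(β):

* `soloInformed_altObstruction_ker_ne_bot`: for finite-dimensional `V`, `W` over a field `K` with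
  `0 < dim V`, `0 < dim W`, and a linear `u : V ⊗ W → V^∨` with `u (v ⊗ w) v = 0` for all `v, w`, the
  kernel of `u` is non-trivial provided `2 ≤ dim W` (dimension count `rs > r`) or `dim V` is odd (an
  alternating form on an odd-dimensional space is degenerate — any characteristic, via the in-tree
  `Literature.AlgebraicGeometry.Motives.exists_finrank_eq_finrank_ker_add_two_mul`; the
  non-vanishing of pure tensors is the in-tree `Literature.NumberTheory.LFunctions.WeilDeligneKunneth.tmul_ne_zero`).

The arithmetic identification of `V`, `W`, `u` with the groups above is NOT formalised (finite flat
group schemes and pseudorepresentations are not in Mathlib); see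
`run/shared/lean/ideation/Langlands/solo-informed/paper/EtaleDirection.md` §7.8 and CLAIMS c74–c75.
-/

namespace Summit.Langlands.Langlands.Theorems

open Module
open scoped TensorProduct

variable {K : Type*} [Field K] {V W : Type*} [AddCommGroup V] [Module K V] [AddCommGroup W]
  [Module K W]

/-- **The linear-algebra heart of G3″.** Let `u : V ⊗ W → V^∨` be linear with every slice
`(v, v″) ↦ u (v ⊗ w) v″` alternating (`u (v ⊗ w) v = 0`).  If `0 < dim V`, `0 < dim W` and either
`2 ≤ dim W` or `dim V` is odd, then `ker u ≠ ⊥`: there is a non-zero unobstructed class.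
(Case `2 ≤ dim W`: `dim (V ⊗ W) = dim V · dim W > dim V = dim V^∨`.  Case `dim V` odd: for any
`w ≠ 0` the alternating form `u (· ⊗ w)` has `dim V = dim ker + 2m`, so its kernel contains some
`v ≠ 0`, and `v ⊗ w` is a non-zero element of `ker u`.) -/
theorem soloInformed_altObstruction_ker_ne_bot [FiniteDimensional K V] [FiniteDimensional K W]
    (u : V ⊗[K] W →ₗ[K] Dual K V) (alt : ∀ (v : V) (w : W), u (v ⊗ₜ w) v = 0)
    (hV : 0 < finrank K V) (hW : 0 < finrank K W)
    (h : 2 ≤ finrank K W ∨ Odd (finrank K V)) :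
    LinearMap.ker u ≠ ⊥ := by
  rcases h with h2 | hodd
  · -- dimension count
    intro hbot
    have hinj : Function.Injective u := LinearMap.ker_eq_bot.1 hbot
    have hle := LinearMap.finrank_le_finrank_of_injective hinj
    rw [Module.finrank_tensorProduct, Subspace.dual_finrank_eq] at hle
    have : finrank K V * 2 ≤ finrank K V * finrank K W := Nat.mul_le_mul_left _ h2
    omega
  · -- odd dimension: every slice is a degenerate alternating form
    obtain ⟨w, hw⟩ := Module.finrank_pos_iff_exists_ne_zero.1 hW
    -- the slice at `w` as a bilinear form on `V`
    let B : LinearMap.BilinForm K V := u ∘ₗ ((TensorProduct.mk K V W).flip w)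
    have hB : ∀ v v' : V, B v v' = u (v ⊗ₜ w) v' := fun v v' => rfl
    have hBalt : B.IsAlt := fun v => by
      change B v v = 0
      rw [hB]
      exact alt v w
    obtain ⟨m, hm⟩ :=
      Literature.AlgebraicGeometry.Motives.exists_finrank_eq_finrank_ker_add_two_mul B hBalt
    have hker : 0 < finrank K (LinearMap.ker B) := by
      rcases hodd with ⟨k, hk⟩
      omega
    obtain ⟨⟨v, hvker⟩, hv0⟩ := Module.finrank_pos_iff_exists_ne_zero.1 hker
    have hv : v ≠ 0 := fun h0 => hv0 (Subtype.ext h0)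
    have hBv : B v = 0 := LinearMap.mem_ker.1 hvker
    intro hbot
    have hmem : v ⊗ₜ[K] w ∈ LinearMap.ker u := by
      rw [LinearMap.mem_ker]
      have : u (v ⊗ₜ w) = B v := rfl
      rw [this, hBv]
    rw [hbot, Submodule.mem_bot] at hmem
    exact Literature.NumberTheory.LFunctions.WeilDeligneKunneth.tmul_ne_zero hv hw hmem

/-- Numerical corollary used in §7.8 (G3″β with `r, s ≥ 1`): in the notation `r = dim V`,
`s = dim W`, an unobstructed non-zero class exists unless `s = 1` and `r` is even — the single cell
in which the first-order theory is silent (prediction P3). -/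
theorem soloInformed_altObstruction_silent_cell [FiniteDimensional K V] [FiniteDimensional K W]
    (u : V ⊗[K] W →ₗ[K] Dual K V) (alt : ∀ (v : V) (w : W), u (v ⊗ₜ w) v = 0)
    (hV : 0 < finrank K V) (hW : 0 < finrank K W) (hker : LinearMap.ker u = ⊥) :
    finrank K W = 1 ∧ Even (finrank K V) := by
  by_contra hc
  refine soloInformed_altObstruction_ker_ne_bot u alt hV hW ?_ hker
  rcases Nat.even_or_odd (finrank K V) with he | ho
  · left
    have : finrank K W ≠ 1 := fun h1 => hc ⟨h1, he⟩
    omega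
  · exact Or.inr ho

end Summit.Langlands.Langlands.Theorems
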